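import Summits.Parity.GeneralizedHardyLittlewood.Theorems.GreenTaoLevelTwoMNTwoSectionEightInstance

/-!
# Route `GreenTaoLevelTwo`, crux `MNTwo` (stmt-Parity-21276), line `birth`, stub `stub_mnVertical`:
# GT 2008b §8 assembled, II — Theorem 4 (μ ⟂ local quadratics, torus form) from Proposition 19

Block V3 of the `stub_mnVertical` census (B. Green, T. Tao, *Quadratic uniformity of the Möbius
function*, Ann. Inst. Fourier 58 (2008) = arXiv:math/0606087, §8): the deduction of Theorem 4
("`μ` is strongly orthogonal to local quadratics": for a `1`-step nilsequence `F(T_gⁿ x)` and a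
phase `φ` locally quadratic on `B_N = {n : F(T_gⁿx) ≠ 0}`,
`𝔼_n μ(n) F(T_gⁿ x) e(−φ(n)) ≪_{G/Γ,A} ‖F‖_Lip log^{-A} N`) from Proposition 19 ("`μ` is strongly
orthogonal to extendible local quadratics"), for the `1`-step nilmanifold realised as the torus
`ℝᵏ/ℤᵏ` with rotation `α` (the form block V1 `…MNTwoMoebiusLipschitzTorus` uses: `F : ℝᵏ → ℝ`
`ℤᵏ`-periodic, `1`-bounded, `M`-Lipschitz for the sup-distance; orbit `x + nα`).

The HYPOTHESIS `hP` is Proposition 19 in printed form, for every saving `A` (the constant may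
depend on `A` and `k`): Bohr balls `B_α(n₀,ρ) = {n ∈ ℤ : ‖(n−n₀)αᵢ‖_{ℝ/ℤ} + |n−n₀|/N < ρ ∀ i}`
(with the extra clause `|n−n₀|/N < ρ`, as in `…MNTwoRotationBohrSize`), `0 < ρ < 10⁻⁵`,
`B_α(n₀,100ρ) ⊆ (N,2N]`, `φ : ℤ → ℝ` locally quadratic on `B_α(n₀,100ρ)` (every `3`-cube with all
`8` vertices in the ball has integral alternating sum), `ψ : ℤ → ℝ≥0` supported on `B_α(n₀,ρ)` with
`|ψ(n) − ψ(n')| ≤ ‖n − n'‖_α := supᵢ‖(n−n')αᵢ‖_{ℝ/ℤ} + |n−n'|/N` (spelled with an auxiliary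
`t ≥ supᵢ`), conclusion `‖∑_{N<n≤2N} μ(n)ψ(n)e(−φ(n))‖ ≤ C N/log^A N`.  Blocks V4–V6 of the
census (§§9–12 of the source) are to prove exactly this hypothesis; block V7 (App. A, Prop. 5)
reduces the vertical-character nilsequences of `stub_mnVertical` to this torus form.

Proof (source, §8): `…SectionEightInstance.core_instance` (soft threshold, bumps, explicit torus
partition of unity, `piece_estimate`), `ρ₀ = 10⁻⁶ log^{-A} N` and Proposition 19 at saving
`A(k+3)` (`constants_bookkeeping`); the case `N = 2` is trivial; `…MNTwoDyadicToFull` for `[1, N]`.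
Def-free:

* `sum_moebius_localQuadratic_dyadic_le` — Theorem 4 on `(N, 2N]`, real `F`, linear in `M`;
* `sum_moebius_localQuadratic_le` — Theorem 4 on `[1, N]`, real `F`, linear in `M`.

References: [GreenTao2008QuadraticMobius] arXiv:math/0606087, Thm. 4, Prop. 19, §8.
-/

noncomputable section

open Finset Real ArithmeticFunction
open scoped FourierTransform ArithmeticFunction.Moebius

namespace Summit.Parity.GeneralizedHardyLittlewood.GreenTaoLevelTwoMNTwoSectionEight

open Summit.Parity.GeneralizedHardyLittlewood.GreenTaoLevelTwoMNTwoSectionEightInstance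
open Summit.Parity.GeneralizedHardyLittlewood.GreenTaoLevelTwoMNTwoDyadicToFull

/-- **GT 2008b Theorem 4 from Proposition 19 (torus rotation, dyadic block, real `F`, linear in the
Lipschitz constant).**  If Proposition 19 holds in dimension `k` for every saving (hypothesis `hP`,
printed form — see the module docstring), then for every `A > 0` there is `C` such that for all
`M ≥ 1`, all `ℤᵏ`-periodic `1`-bounded `M`-Lipschitz `F : ℝᵏ → ℝ`, all `N ≥ 2`, `α, x ∈ ℝᵏ` and all
`φ : ℤ → ℝ` locally quadratic on `{N < n ≤ 2N : F(x + nα) ≠ 0}`: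
`‖∑_{N<n≤2N} μ(n) F(x+nα) e(−φ(n))‖ ≤ C M N / log^A N`.
[cite: GreenTao2008QuadraticMobius, Theorem 4 and §8 (deduction from Proposition 19)] -/
theorem sum_moebius_localQuadratic_dyadic_le (k : ℕ)
    (hP : ∀ A : ℝ, 0 < A → ∃ C : ℝ, ∀ N : ℕ, 2 ≤ N → ∀ (α : Fin k → ℝ) (n₀ : ℤ) (ρ : ℝ),
      0 < ρ → 100000 * ρ < 1 →
      (∀ n : ℤ, ((∀ i, ‖((((n - n₀ : ℤ) : ℝ) * α i : ℝ) : AddCircle (1 : ℝ))‖ +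
          |((n - n₀ : ℤ) : ℝ)| / N < 100 * ρ) ∧ |((n - n₀ : ℤ) : ℝ)| / N < 100 * ρ) →
        (N : ℤ) < n ∧ n ≤ 2 * N) →
      ∀ φ : ℤ → ℝ,
        (∀ n h₁ h₂ h₃ : ℤ,
          (∀ e₁ e₂ e₃ : ℕ, e₁ ≤ 1 → e₂ ≤ 1 → e₃ ≤ 1 →
            (∀ i, ‖((((n + e₁ * h₁ + e₂ * h₂ + e₃ * h₃ - n₀ : ℤ) : ℝ) * α i : ℝ) :
                AddCircle (1 : ℝ))‖ +
              |((n + e₁ * h₁ + e₂ * h₂ + e₃ * h₃ - n₀ : ℤ) : ℝ)| / N < 100 * ρ) ∧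
            |((n + e₁ * h₁ + e₂ * h₂ + e₃ * h₃ - n₀ : ℤ) : ℝ)| / N < 100 * ρ) →
          ∃ z : ℤ, φ (n + h₁ + h₂ + h₃) - φ (n + h₁ + h₂) - φ (n + h₁ + h₃) - φ (n + h₂ + h₃)
            + φ (n + h₁) + φ (n + h₂) + φ (n + h₃) - φ n = z) →
        ∀ ψ : ℤ → ℝ, (∀ n, 0 ≤ ψ n) →
          (∀ n, ψ n ≠ 0 →
            (∀ i, ‖((((n - n₀ : ℤ) : ℝ) * α i : ℝ) : AddCircle (1 : ℝ))‖ +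
                |((n - n₀ : ℤ) : ℝ)| / N < ρ) ∧ |((n - n₀ : ℤ) : ℝ)| / N < ρ) →
          (∀ (n n' : ℤ) (t : ℝ), 0 ≤ t →
            (∀ i, ‖((((n - n' : ℤ) : ℝ) * α i : ℝ) : AddCircle (1 : ℝ))‖ ≤ t) →
              |ψ n - ψ n'| ≤ t + |((n - n' : ℤ) : ℝ)| / N) →
          ‖∑ n ∈ Ioc N (2 * N), ((μ n : ℝ) : ℂ) * ((ψ n : ℝ) : ℂ) * (𝐞 (-(φ n)) : ℂ)‖ ≤
            C * N / Real.log N ^ A)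
    {A : ℝ} (hA : 0 < A) :
    ∃ C : ℝ, ∀ M : ℝ, 1 ≤ M → ∀ F : (Fin k → ℝ) → ℝ,
      (∀ y (i : Fin k), F (y + Pi.single i 1) = F y) → (∀ y, |F y| ≤ 1) →
      (∀ y y', |F y - F y'| ≤ M * dist y y') →
      ∀ N : ℕ, 2 ≤ N → ∀ (α x : Fin k → ℝ) (φ : ℤ → ℝ),
        (∀ n h₁ h₂ h₃ : ℤ,
          (∀ e₁ e₂ e₃ : ℕ, e₁ ≤ 1 → e₂ ≤ 1 → e₃ ≤ 1 →
            (N : ℤ) < n + e₁ * h₁ + e₂ * h₂ + e₃ * h₃ ∧ n + e₁ * h₁ + e₂ * h₂ + e₃ * h₃ ≤ 2 * N ∧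
              F (x + ((n + e₁ * h₁ + e₂ * h₂ + e₃ * h₃ : ℤ) : ℝ) • α) ≠ 0) →
          ∃ z : ℤ, φ (n + h₁ + h₂ + h₃) - φ (n + h₁ + h₂) - φ (n + h₁ + h₃) - φ (n + h₂ + h₃)
            + φ (n + h₁) + φ (n + h₂) + φ (n + h₃) - φ n = z) →
        ‖∑ n ∈ Ioc N (2 * N), ((μ n : ℝ) : ℂ) * (F (x + (n : ℝ) • α) : ℂ) * (𝐞 (-(φ n)) : ℂ)‖ ≤
          C * M * N / Real.log N ^ A := by
  classical
  have hA' : 0 < A * ((k : ℝ) + 3) := by positivity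
  obtain ⟨C₀, hC₀⟩ := hP (A * ((k : ℝ) + 3)) hA'
  have hC'0 : 0 ≤ max C₀ 0 := le_max_right _ _
  have h2A : 0 ≤ (2 * A) ^ A := by positivity
  have hCbig0 : 0 ≤ 2 * 9 ^ (k + 1) * (9 * k + 17) * (10 : ℝ) ^ (6 * (k + 2)) * max C₀ 0 := by
    positivity
  refine ⟨2 + (2 * A) ^ A + 2 * 9 ^ (k + 1) * (9 * k + 17) * (10 : ℝ) ^ (6 * (k + 2)) * max C₀ 0, ?_⟩
  intro M hM F hFper hF1 hFlip N hN α x φ hφ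
  have hM0 : 0 ≤ M := by linarith
  have hNr : (2 : ℝ) ≤ N := by exact_mod_cast hN
  have hNpos : (0 : ℝ) < N := by linarith
  have hlogpos : 0 < Real.log N := Real.log_pos (by linarith)
  have hLpos : 0 < Real.log N ^ A := Real.rpow_pos_of_pos hlogpos A
  -- Case `N = 2`: the trivial bound suffices since `log^A 2 ≤ 1`
  rcases Nat.lt_or_ge N 3 with hN3 | hN3
  · have hN2 : N = 2 := by omega
    have htriv : ‖∑ n ∈ Ioc N (2 * N), ((μ n : ℝ) : ℂ) * (F (x + (n : ℝ) • α) : ℂ) *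
        (𝐞 (-(φ n)) : ℂ)‖ ≤ N := by
      calc ‖∑ n ∈ Ioc N (2 * N), ((μ n : ℝ) : ℂ) * (F (x + (n : ℝ) • α) : ℂ) * (𝐞 (-(φ n)) : ℂ)‖
          ≤ ∑ n ∈ Ioc N (2 * N), ‖((μ n : ℝ) : ℂ) * (F (x + (n : ℝ) • α) : ℂ) *
              (𝐞 (-(φ n)) : ℂ)‖ := norm_sum_le _ _
        _ ≤ ∑ n ∈ Ioc N (2 * N), (1 : ℝ) := sum_le_sum fun n _ =>
            (GreenTaoLevelTwoMNTwoSectionEightPiece.norm_moebius_mul_mul_fourierChar_le _ _ _).trans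
              (hF1 _)
        _ = N := by
            rw [sum_const, Nat.card_Ioc, nsmul_eq_mul, mul_one, show 2 * N - N = N by omega]
    have hlog2 : Real.log N ^ A ≤ 1 := by
      rw [hN2]; push_cast
      apply Real.rpow_le_one (Real.log_nonneg (by norm_num)) _ hA.le
      have := Real.log_two_lt_d9; linarith
    refine htriv.trans ?_
    rw [le_div_iff₀ hLpos]
    have h2 : (N : ℝ) * Real.log N ^ A ≤ N * 1 := mul_le_mul_of_nonneg_left hlog2 hNpos.le
    have hcoef : (1 : ℝ) ≤ (2 + (2 * A) ^ A +
        2 * 9 ^ (k + 1) * (9 * k + 17) * (10 : ℝ) ^ (6 * (k + 2)) * max C₀ 0) * M := by nlinarith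
    have h3 := mul_le_mul_of_nonneg_right hcoef hNpos.le
    linarith
  -- Case `N ≥ 3`: `L = log^A N ≥ 1`
  have hN3r : (3 : ℝ) ≤ N := by exact_mod_cast hN3
  have hlog1 : 1 ≤ Real.log N := by
    rw [← Real.log_exp 1]
    apply Real.log_le_log (Real.exp_pos 1)
    have := Real.exp_one_lt_d9; linarith
  obtain ⟨L, hL⟩ : ∃ L : ℝ, Real.log N ^ A = L := ⟨_, rfl⟩
  have hL1 : 1 ≤ L := by rw [← hL]; exact Real.one_le_rpow hlog1 hA.le
  have hLpos' : 0 < L := by linarith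
  have hLN : L ≤ (2 * A) ^ A * N := by
    rw [← hL]
    refine (log_rpow_le_mul_sqrt hA (by linarith)).trans ?_
    apply mul_le_mul_of_nonneg_left _ h2A
    rw [Real.sqrt_le_left (by linarith)]; nlinarith
  have hL' : Real.log N ^ (A * ((k : ℝ) + 3)) = L ^ (k + 2) * L := by
    rw [Real.rpow_mul hlogpos.le, hL, show ((k : ℝ) + 3) = ((k + 3 : ℕ) : ℝ) by push_cast; ring,
      Real.rpow_natCast, pow_succ]
  -- parameters `ρ₀ = 10⁻⁶/L`, `m = ⌈8/ρ₀⌉`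
  obtain ⟨ρ₀, hρ₀⟩ : ∃ ρ₀ : ℝ, ρ₀ = 1 / (10 ^ 6 * L) := ⟨_, rfl⟩
  have hρ₀pos : 0 < ρ₀ := by rw [hρ₀]; positivity
  have hR : 1 / ρ₀ = 10 ^ 6 * L := by rw [hρ₀, one_div_one_div]
  have hR1 : 1 ≤ 1 / ρ₀ := by rw [hR]; nlinarith
  have hρ₀' : 100000 * ρ₀ < 1 := by
    rw [hρ₀, mul_one_div, div_lt_one (by positivity)]; nlinarith
  obtain ⟨m, hm⟩ : ∃ m : ℕ, m = ⌈8 / ρ₀⌉₊ := ⟨_, rfl⟩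
  have hm8 : 8 / ρ₀ ≤ m := by rw [hm]; exact Nat.le_ceil _
  have hm9 : (m : ℝ) ≤ 9 * (1 / ρ₀) := by
    have := Nat.ceil_lt_add_one (show 0 ≤ 8 / ρ₀ by positivity)
    rw [← hm] at this
    have h8 : 8 / ρ₀ = 8 * (1 / ρ₀) := by ring
    linarith
  have hm2r : (2 : ℝ) ≤ m := by
    have h8 : 8 / ρ₀ = 8 * (1 / ρ₀) := by ring
    linarith
  have hm2 : 2 ≤ m := by exact_mod_cast hm2r
  have hmpos : (0 : ℝ) < m := by linarith
  have h2m : 2 / (m : ℝ) ≤ ρ₀ / 4 := by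
    rw [div_le_iff₀ hmpos]
    have : 8 / ρ₀ * ρ₀ = 8 := by field_simp
    nlinarith
  -- Proposition 19 at this `N`, saving `A (k+3)`, constant `max C₀ 0`
  have hP' := fun (n₀ : ℤ) (ρ : ℝ) (hρ : 0 < ρ) (hρ' : 100000 * ρ < 1) hB (φ' : ℤ → ℝ) hφ'
      (ψ : ℤ → ℝ) hψ0 hψs hψl =>
    (hC₀ N hN α n₀ ρ hρ hρ' hB φ' hφ' ψ hψ0 hψs hψl).trans
      (div_le_div_of_nonneg_right (mul_le_mul_of_nonneg_right (le_max_left C₀ 0) hNpos.le)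
        (Real.rpow_nonneg hlogpos.le _))
  have hS := core_instance k (by omega : 1 ≤ N) hM0 hρ₀pos hρ₀' hC'0 hm2 h2m α x F hFper hF1
    hFlip φ hφ hP'
  rw [hL'] at hS
  have hfin := constants_bookkeeping (k := k) hC'0 hM (by linarith : (1 : ℝ) ≤ N) hL1 h2A hLN hρ₀
    hm9 hS
  rw [hL]
  exact hfin

/-- **GT 2008b Theorem 4 from Proposition 19 (torus rotation, initial segment `[1, N]`, real `F`,
linear in the Lipschitz constant).**  As `sum_moebius_localQuadratic_dyadic_le`, for
`φ` locally quadratic on `{1 ≤ n ≤ N : F(x + nα) ≠ 0}` and the sum over `1 ≤ n ≤ N`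
(dyadic decomposition `…MNTwoDyadicToFull`).
[cite: GreenTao2008QuadraticMobius, Theorem 4 and §8] -/
theorem sum_moebius_localQuadratic_le (k : ℕ)
    (hP : ∀ A : ℝ, 0 < A → ∃ C : ℝ, ∀ N : ℕ, 2 ≤ N → ∀ (α : Fin k → ℝ) (n₀ : ℤ) (ρ : ℝ),
      0 < ρ → 100000 * ρ < 1 →
      (∀ n : ℤ, ((∀ i, ‖((((n - n₀ : ℤ) : ℝ) * α i : ℝ) : AddCircle (1 : ℝ))‖ +
          |((n - n₀ : ℤ) : ℝ)| / N < 100 * ρ) ∧ |((n - n₀ : ℤ) : ℝ)| / N < 100 * ρ) →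
        (N : ℤ) < n ∧ n ≤ 2 * N) →
      ∀ φ : ℤ → ℝ,
        (∀ n h₁ h₂ h₃ : ℤ,
          (∀ e₁ e₂ e₃ : ℕ, e₁ ≤ 1 → e₂ ≤ 1 → e₃ ≤ 1 →
            (∀ i, ‖((((n + e₁ * h₁ + e₂ * h₂ + e₃ * h₃ - n₀ : ℤ) : ℝ) * α i : ℝ) :
                AddCircle (1 : ℝ))‖ +
              |((n + e₁ * h₁ + e₂ * h₂ + e₃ * h₃ - n₀ : ℤ) : ℝ)| / N < 100 * ρ) ∧
            |((n + e₁ * h₁ + e₂ * h₂ + e₃ * h₃ - n₀ : ℤ) : ℝ)| / N < 100 * ρ) →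
          ∃ z : ℤ, φ (n + h₁ + h₂ + h₃) - φ (n + h₁ + h₂) - φ (n + h₁ + h₃) - φ (n + h₂ + h₃)
            + φ (n + h₁) + φ (n + h₂) + φ (n + h₃) - φ n = z) →
        ∀ ψ : ℤ → ℝ, (∀ n, 0 ≤ ψ n) →
          (∀ n, ψ n ≠ 0 →
            (∀ i, ‖((((n - n₀ : ℤ) : ℝ) * α i : ℝ) : AddCircle (1 : ℝ))‖ +
                |((n - n₀ : ℤ) : ℝ)| / N < ρ) ∧ |((n - n₀ : ℤ) : ℝ)| / N < ρ) →
          (∀ (n n' : ℤ) (t : ℝ), 0 ≤ t →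
            (∀ i, ‖((((n - n' : ℤ) : ℝ) * α i : ℝ) : AddCircle (1 : ℝ))‖ ≤ t) →
              |ψ n - ψ n'| ≤ t + |((n - n' : ℤ) : ℝ)| / N) →
          ‖∑ n ∈ Ioc N (2 * N), ((μ n : ℝ) : ℂ) * ((ψ n : ℝ) : ℂ) * (𝐞 (-(φ n)) : ℂ)‖ ≤
            C * N / Real.log N ^ A)
    {A : ℝ} (hA : 0 < A) :
    ∃ C : ℝ, ∀ M : ℝ, 1 ≤ M → ∀ F : (Fin k → ℝ) → ℝ,
      (∀ y (i : Fin k), F (y + Pi.single i 1) = F y) → (∀ y, |F y| ≤ 1) →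
      (∀ y y', |F y - F y'| ≤ M * dist y y') →
      ∀ N : ℕ, 2 ≤ N → ∀ (α x : Fin k → ℝ) (φ : ℤ → ℝ),
        (∀ n h₁ h₂ h₃ : ℤ,
          (∀ e₁ e₂ e₃ : ℕ, e₁ ≤ 1 → e₂ ≤ 1 → e₃ ≤ 1 →
            (1 : ℤ) ≤ n + e₁ * h₁ + e₂ * h₂ + e₃ * h₃ ∧ n + e₁ * h₁ + e₂ * h₂ + e₃ * h₃ ≤ N ∧
              F (x + ((n + e₁ * h₁ + e₂ * h₂ + e₃ * h₃ : ℤ) : ℝ) • α) ≠ 0) →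
          ∃ z : ℤ, φ (n + h₁ + h₂ + h₃) - φ (n + h₁ + h₂) - φ (n + h₁ + h₃) - φ (n + h₂ + h₃)
            + φ (n + h₁) + φ (n + h₂) + φ (n + h₃) - φ n = z) →
        ‖∑ n ∈ Icc 1 N, ((μ n : ℝ) : ℂ) * (F (x + (n : ℝ) • α) : ℂ) * (𝐞 (-(φ n)) : ℂ)‖ ≤
          C * M * N / Real.log N ^ A := by
  obtain ⟨C, hC⟩ := sum_moebius_localQuadratic_dyadic_le k hP hA
  refine ⟨2 ^ A * max C 0 + 8 * (2 * A) ^ A, ?_⟩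
  intro M hM F hFper hF1 hFlip N hN α x φ hφ
  have hM0 : 0 ≤ M := by linarith
  have hCM : 0 ≤ max C 0 * M := by positivity
  have hNpos : (0 : ℝ) < N := by exact_mod_cast (show 0 < N by omega)
  have hlogpos : 0 < Real.log N := Real.log_pos (by exact_mod_cast (show 1 < N by omega))
  have hdy : ∀ m : ℕ, 2 ≤ m → Real.sqrt N ≤ m → 2 * m ≤ N →
      ‖∑ n ∈ Ioc m (2 * m), ((μ n : ℝ) : ℂ) * (F (x + (n : ℝ) • α) : ℂ) * (𝐞 (-(φ n)) : ℂ)‖ ≤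
        max C 0 * M * m / Real.log m ^ A := by
    intro m hm2 _ h2m
    have hmpos : (0 : ℝ) < m := by exact_mod_cast (show 0 < m by omega)
    have h := hC M hM F hFper hF1 hFlip m hm2 α x φ (fun n h₁ h₂ h₃ hc => hφ n h₁ h₂ h₃
      fun e₁ e₂ e₃ he₁ he₂ he₃ => by
        obtain ⟨h1, h2, h3⟩ := hc e₁ e₂ e₃ he₁ he₂ he₃
        exact ⟨by omega, by omega, h3⟩)
    refine h.trans (div_le_div_of_nonneg_right ?_ (Real.rpow_nonneg (Real.log_nonneg
      (by exact_mod_cast (show 1 ≤ m by omega))) A))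
    exact mul_le_mul_of_nonneg_right (mul_le_mul_of_nonneg_right (le_max_left C 0) hM0) hmpos.le
  have h := norm_sum_Icc_le_of_dyadic hA hCM hN
    (fun n => ((μ n : ℝ) : ℂ) * (F (x + (n : ℝ) • α) : ℂ) * (𝐞 (-(φ n)) : ℂ))
    (fun n => (GreenTaoLevelTwoMNTwoSectionEightPiece.norm_moebius_mul_mul_fourierChar_le
      _ _ _).trans (hF1 _))
    (fun m hm2 hms h2m => by rw [mul_assoc (max C 0) M m, ← mul_assoc]; exact hdy m hm2 hms h2m)
  refine h.trans ?_
  have hLpos : 0 < Real.log N ^ A := Real.rpow_pos_of_pos hlogpos A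
  apply div_le_div_of_nonneg_right _ hLpos.le
  have h1 : 8 * (2 * A) ^ A * (N : ℝ) ≤ 8 * (2 * A) ^ A * M * N := by
    have : 0 ≤ 8 * (2 * A) ^ A * (N : ℝ) := by positivity
    nlinarith
  nlinarith

end Summit.Parity.GeneralizedHardyLittlewood.GreenTaoLevelTwoMNTwoSectionEight
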